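import Literature.Probability.RandomPlanarGeometry.LoewnerImageFlowContinuity
import HarnessLib

/-!
# The capacity clock of the conformal image of a Loewner chain: `σ(t) = ∫₀ᵗ h_r'(W_r)² dr` and its inverse

[LSW] 2003 §5 ((5.1): `∂_t g̃_t(z) = 2 h_t'(W_t)²/(g̃_t(z) − W̃_t)`; "after the time change
`t ↦ ∫₀ᵗ h_s'(W_s)² ds` the maps `g̃` form a Loewner chain"); G. F. Lawler (2005), §4.6.1,
Prop. 4.40–4.41 (`hcap(K*_t) = ∫₀ᵗ 2Φ_s'(U_s)² ds` … "`K*_{σ(t)}` is a Loewner chain with driving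
function `U*_t = Φ_{σ(t)}(U_{σ(t)})`"). For a continuous driving function `W`, a nonempty `*`-hull
`A` and an alive time `β` (`Disjoint (closedHull W β) A`) we construct

* `imageClockRate W A r = d_r²`, `d_r = Φ'_{B_r}(0) = h_r'(W_r) ∈ (0, 1]` (read at `r.toNNReal`),
  continuous on `[0, β]` and bounded below there by some `m > 0` (`exists_forall_le_imageClockRate`);
* `imageClock W A t = ∫₀ᵗ d_r² dr` — **the capacity clock** `σ`: `σ 0 = 0`,
  `m (t' − t) ≤ σ t' − σ t ≤ t' − t` on `[0, β]` (`imageClock_sub_le`, `le_imageClock_sub`), strictly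
  increasing, continuous, `HasDerivAt σ (d_t²) t` on `(0, β)`;
* `imageClockInv W A β q` — **the inverse clock** `τ = σ⁻¹ : [0, σ β] → [0, β]`
  (`imageClock_imageClockInv`, `imageClockInv_imageClock`), `1/m`-Lipschitz hence continuous, strictly
  increasing, with `HasDerivAt τ (d_{τ q}²)⁻¹ q` on `(0, σ β)` (`hasDerivAt_imageClockInv`).

The sequel reads the image driving function and the image flow in capacity time
(`W̃ ∘ τ`, `g̃ ∘ τ`) and identifies them with a solution of the chordal Loewner equation
(`Loewner.IsSolution`), i.e. with the tree's Loewner chain of the driving function `W̃ ∘ τ`.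
No named fact; three definitions with bodies.

## References

* [LSW] 2003, §5 (5.1). [LawlerSchrammWerner2003Restriction]
* G. F. Lawler (2005), §4.6.1 Prop. 4.40–4.41; Remark 4.5 (time changes). [Lawler2005]
-/

noncomputable section

open Set Filter Metric Function MeasureTheory intervalIntegral
open _root_.Complex _root_.Topology _root_.Real
open scoped NNReal

namespace Literature.Probability.RandomPlanarGeometry

namespace Loewner

variable {W : ℝ≥0 → ℝ} {A : Set ℂ}

/-! ### The clock rate `d_r²` -/

/-- **The clock rate `d_r² = h_r'(W_r)²`** (`d_r = starDeriv (slidHull W A r)`, read at `r.toNNReal`).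
[cite: LawlerSchrammWerner2003Restriction, §5 (5.1)] -/
def imageClockRate (W : ℝ≥0 → ℝ) (A : Set ℂ) (r : ℝ) : ℝ :=
  starDeriv (slidHull W A r.toNNReal) ^ 2

/-- `0 < d_r² ≤ 1` (for every `r`: the canonical derivative of any set lies in `(0, 1]`). [folklore] -/
theorem imageClockRate_pos_le_one (W : ℝ≥0 → ℝ) (A : Set ℂ) (r : ℝ) :
    0 < imageClockRate W A r ∧ imageClockRate W A r ≤ 1 := by
  obtain ⟨h0, h1⟩ := starDeriv_pos_le_one (slidHull W A r.toNNReal)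
  exact ⟨by rw [imageClockRate]; positivity, by rw [imageClockRate]; exact pow_le_one₀ h0.le h1⟩

/-- **The clock rate is continuous on `[0, β]`** (`β` alive; `continuousWithinAt_starDeriv_slidHull`).
[folklore] -/
theorem continuousOn_imageClockRate (hW : Continuous W) (hA : IsStarHull A) (hne : A.Nonempty) {β : ℝ≥0}
    (hβ : Disjoint (closedHull W β) A) : ContinuousOn (imageClockRate W A) (Icc (0 : ℝ) β) := by
  intro t ht
  have hle : t.toNNReal ≤ β := by rw [← NNReal.coe_le_coe, Real.coe_toNNReal _ ht.1]; exact ht.2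
  have h := continuousWithinAt_comp_toNNReal hβ t
    (continuousWithinAt_starDeriv_slidHull hW hA hne (alive_mono hle hβ))
  exact h.pow 2

/-- **A positive lower bound of the clock rate on `[0, β]`** (continuous and positive on a compact
interval). [folklore] -/
theorem exists_forall_le_imageClockRate (hW : Continuous W) (hA : IsStarHull A) (hne : A.Nonempty)
    {β : ℝ≥0} (hβ : Disjoint (closedHull W β) A) :
    ∃ m : ℝ, 0 < m ∧ m ≤ 1 ∧ ∀ r ∈ Icc (0 : ℝ) β, m ≤ imageClockRate W A r := by
  obtain ⟨r₀, hr₀, hmin⟩ := isCompact_Icc.exists_isMinOn (⟨0, le_rfl, β.coe_nonneg⟩ : (Icc (0 : ℝ) β).Nonempty)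
    (continuousOn_imageClockRate hW hA hne hβ)
  obtain ⟨h0, h1⟩ := imageClockRate_pos_le_one W A r₀
  exact ⟨imageClockRate W A r₀, h0, h1, fun r hr ↦ hmin hr⟩

/-! ### The clock `σ(t) = ∫₀ᵗ d_r² dr` -/

/-- **The capacity clock `σ(t) = ∫₀ᵗ h_r'(W_r)² dr`** of the conformal image
(`2σ(t) = hcap(Φ_A(K_t))`, Lawler's Prop. 4.41). [cite: Lawler2005, Prop. 4.41] -/
def imageClock (W : ℝ≥0 → ℝ) (A : Set ℂ) (t : ℝ) : ℝ :=
  ∫ r in (0 : ℝ)..t, imageClockRate W A r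

/-- `σ(0) = 0`. [folklore] -/
@[simp] theorem imageClock_zero (W : ℝ≥0 → ℝ) (A : Set ℂ) : imageClock W A 0 = 0 := by
  simp [imageClock]

section Clock

variable (hW : Continuous W) (hA : IsStarHull A) (hne : A.Nonempty) {β : ℝ≥0} (hβ : Disjoint (closedHull W β) A)
include hW hA hne hβ

/-- The rate is interval integrable on subintervals of `[0, β]`. [folklore] -/
theorem intervalIntegrable_imageClockRate {a b : ℝ} (ha : a ∈ Icc (0 : ℝ) β) (hb : b ∈ Icc (0 : ℝ) β) :
    IntervalIntegrable (imageClockRate W A) volume a b :=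
  ((continuousOn_imageClockRate hW hA hne hβ).mono (uIcc_subset_Icc ha hb)).intervalIntegrable

/-- **Increments of the clock**: for `0 ≤ t ≤ t' ≤ β`, `σ t' − σ t = ∫_t^{t'} d² ∈ [m (t' − t), t' − t]`.
[folklore] -/
theorem imageClock_sub_mem {t t' : ℝ} (ht : 0 ≤ t) (htt' : t ≤ t') (ht' : t' ≤ β) {m : ℝ}
    (hm : ∀ r ∈ Icc (0 : ℝ) β, m ≤ imageClockRate W A r) :
    m * (t' - t) ≤ imageClock W A t' - imageClock W A t ∧ imageClock W A t' - imageClock W A t ≤ t' - t := by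
  have htI : t ∈ Icc (0 : ℝ) β := ⟨ht, htt'.trans ht'⟩
  have ht'I : t' ∈ Icc (0 : ℝ) β := ⟨ht.trans htt', ht'⟩
  have h0I : (0 : ℝ) ∈ Icc (0 : ℝ) β := ⟨le_rfl, β.coe_nonneg⟩
  have hsub : imageClock W A t' - imageClock W A t = ∫ r in t..t', imageClockRate W A r := by
    rw [imageClock, imageClock, integral_interval_sub_left
      (intervalIntegrable_imageClockRate hW hA hne hβ h0I ht'I) (intervalIntegrable_imageClockRate hW hA hne hβ h0I htI)]
  rw [hsub]
  have hi := intervalIntegrable_imageClockRate hW hA hne hβ htI ht'I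
  constructor
  · have := integral_mono_on htt' (intervalIntegrable_const) hi
      (fun r hr ↦ hm r ⟨ht.trans hr.1, hr.2.trans ht'⟩)
    rwa [intervalIntegral.integral_const, smul_eq_mul, mul_comm] at this
  · have := integral_mono_on htt' hi (intervalIntegrable_const)
      (fun r _ ↦ (imageClockRate_pos_le_one W A r).2)
    rwa [intervalIntegral.integral_const, smul_eq_mul, mul_one] at this

/-- **The clock is strictly increasing on `[0, β]`.** [folklore] -/
theorem strictMonoOn_imageClock : StrictMonoOn (imageClock W A) (Icc (0 : ℝ) β) := by
  obtain ⟨m, hm0, -, hm⟩ := exists_forall_le_imageClockRate hW hA hne hβ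
  intro t ht t' ht' hlt
  have := (imageClock_sub_mem hW hA hne hβ ht.1 hlt.le ht'.2 hm).1
  nlinarith

/-- **The clock is `1`-Lipschitz on `[0, β]`**, in particular continuous. [folklore] -/
theorem abs_imageClock_sub_le {t t' : ℝ} (ht : t ∈ Icc (0 : ℝ) β) (ht' : t' ∈ Icc (0 : ℝ) β) :
    |imageClock W A t' - imageClock W A t| ≤ |t' - t| := by
  obtain ⟨m, -, -, hm⟩ := exists_forall_le_imageClockRate hW hA hne hβ
  rcases le_total t t' with h | h
  · have := (imageClock_sub_mem hW hA hne hβ ht.1 h ht'.2 hm)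
    have h0 : 0 ≤ imageClock W A t' - imageClock W A t := by
      have := (strictMonoOn_imageClock hW hA hne hβ).monotoneOn ht ht' h; linarith
    rw [abs_of_nonneg h0, abs_of_nonneg (sub_nonneg.2 h)]; exact this.2
  · have := (imageClock_sub_mem hW hA hne hβ ht'.1 h ht.2 hm)
    have h0 : 0 ≤ imageClock W A t - imageClock W A t' := by
      have := (strictMonoOn_imageClock hW hA hne hβ).monotoneOn ht' ht h; linarith
    rw [abs_sub_comm, abs_of_nonneg h0, abs_sub_comm, abs_of_nonneg (sub_nonneg.2 h)]; exact this.2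

/-- The clock is continuous on `[0, β]`. [folklore] -/
theorem continuousOn_imageClock : ContinuousOn (imageClock W A) (Icc (0 : ℝ) β) := by
  rw [Metric.continuousOn_iff]
  intro t ht ε hε
  refine ⟨ε, hε, fun t' ht' htt' ↦ ?_⟩
  rw [Real.dist_eq] at htt' ⊢
  exact (abs_imageClock_sub_le hW hA hne hβ ht ht').trans_lt htt'

/-- `0 ≤ σ t ≤ t` on `[0, β]`. [folklore] -/
theorem imageClock_mem {t : ℝ} (ht : t ∈ Icc (0 : ℝ) β) : imageClock W A t ∈ Icc (0 : ℝ) t := by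
  obtain ⟨m, hm0, -, hm⟩ := exists_forall_le_imageClockRate hW hA hne hβ
  have := imageClock_sub_mem hW hA hne hβ le_rfl ht.1 ht.2 hm
  rw [imageClock_zero, sub_zero, sub_zero] at this
  exact ⟨(mul_nonneg hm0.le ht.1).trans this.1, this.2⟩

/-- **`HasDerivAt σ (d_t²) t` on `(0, β)`** (fundamental theorem of calculus, continuous rate).
[cite: Lawler2005, Prop. 4.41] -/
theorem hasDerivAt_imageClock {t : ℝ} (ht : t ∈ Ioo (0 : ℝ) β) :
    HasDerivAt (imageClock W A) (imageClockRate W A t) t := by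
  have hc := continuousOn_imageClockRate hW hA hne hβ
  have hco : ContinuousOn (imageClockRate W A) (Ioo (0 : ℝ) β) := hc.mono Ioo_subset_Icc_self
  exact integral_hasDerivAt_right
    (intervalIntegrable_imageClockRate hW hA hne hβ ⟨le_rfl, β.coe_nonneg⟩ ⟨ht.1.le, ht.2.le⟩)
    (hco.stronglyMeasurableAtFilter isOpen_Ioo t ht) (hco.continuousAt (isOpen_Ioo.mem_nhds ht))

end Clock

/-! ### The inverse clock `τ = σ⁻¹` on `[0, σ β]` -/

/-- **The inverse clock `τ(q) = σ⁻¹(q)`**, a choice of preimage in `[0, β]` (meaningful for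
`q ∈ [0, σ β]`). [cite: Lawler2005, Remark 4.5 (time change by capacity)] -/
def imageClockInv (W : ℝ≥0 → ℝ) (A : Set ℂ) (β : ℝ≥0) (q : ℝ) : ℝ :=
  Function.invFunOn (imageClock W A) (Icc (0 : ℝ) β) q

section Inverse

variable (hW : Continuous W) (hA : IsStarHull A) (hne : A.Nonempty) {β : ℝ≥0} (hβ : Disjoint (closedHull W β) A)
include hW hA hne hβ

/-- Every `q ∈ [0, σ β]` is a clock value `σ t`, `t ∈ [0, β]` (intermediate value theorem). [folklore] -/
theorem exists_imageClock_eq {q : ℝ} (hq : q ∈ Icc (0 : ℝ) (imageClock W A β)) :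
    ∃ t ∈ Icc (0 : ℝ) β, imageClock W A t = q := by
  have := intermediate_value_Icc β.coe_nonneg (continuousOn_imageClock hW hA hne hβ)
  rw [imageClock_zero] at this
  exact this hq

/-- `τ q ∈ [0, β]` and `σ (τ q) = q` for `q ∈ [0, σ β]`. [folklore] -/
theorem imageClockInv_spec {q : ℝ} (hq : q ∈ Icc (0 : ℝ) (imageClock W A β)) :
    imageClockInv W A β q ∈ Icc (0 : ℝ) β ∧ imageClock W A (imageClockInv W A β q) = q :=
  Function.invFunOn_pos (exists_imageClock_eq hW hA hne hβ hq)

/-- `σ (τ q) = q`. [folklore] -/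
theorem imageClock_imageClockInv {q : ℝ} (hq : q ∈ Icc (0 : ℝ) (imageClock W A β)) :
    imageClock W A (imageClockInv W A β q) = q :=
  (imageClockInv_spec hW hA hne hβ hq).2

/-- `τ (σ t) = t` for `t ∈ [0, β]`. [folklore] -/
theorem imageClockInv_imageClock {t : ℝ} (ht : t ∈ Icc (0 : ℝ) β) :
    imageClockInv W A β (imageClock W A t) = t := by
  have hmono := strictMonoOn_imageClock hW hA hne hβ
  have hq : imageClock W A t ∈ Icc (0 : ℝ) (imageClock W A β) :=
    ⟨(imageClock_mem hW hA hne hβ ht).1, hmono.monotoneOn ht ⟨β.coe_nonneg, le_rfl⟩ ht.2⟩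
  exact hmono.injOn (imageClockInv_spec hW hA hne hβ hq).1 ht (imageClock_imageClockInv hW hA hne hβ hq)

/-- `τ 0 = 0`. [folklore] -/
theorem imageClockInv_zero : imageClockInv W A β 0 = 0 := by
  have := imageClockInv_imageClock hW hA hne hβ (t := 0) ⟨le_rfl, β.coe_nonneg⟩
  rwa [imageClock_zero] at this

/-- **`τ` is `1/m`-Lipschitz on `[0, σ β]`** (`m` a lower bound of the rate): `|τ q − τ q'| ≤ |q − q'|/m`.
[folklore] -/
theorem abs_imageClockInv_sub_le {m : ℝ} (hm0 : 0 < m) (hm : ∀ r ∈ Icc (0 : ℝ) β, m ≤ imageClockRate W A r)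
    {q q' : ℝ} (hq : q ∈ Icc (0 : ℝ) (imageClock W A β)) (hq' : q' ∈ Icc (0 : ℝ) (imageClock W A β)) :
    |imageClockInv W A β q - imageClockInv W A β q'| ≤ |q - q'| / m := by
  obtain ⟨ht, hσt⟩ := imageClockInv_spec hW hA hne hβ hq
  obtain ⟨ht', hσt'⟩ := imageClockInv_spec hW hA hne hβ hq'
  set t := imageClockInv W A β q
  set t' := imageClockInv W A β q'
  rw [le_div_iff₀ hm0]
  rcases le_total t t' with h | h
  · have := (imageClock_sub_mem hW hA hne hβ ht.1 h ht'.2 hm).1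
    rw [hσt, hσt'] at this
    rw [abs_sub_comm, abs_of_nonneg (sub_nonneg.2 h), abs_sub_comm,
      abs_of_nonneg (by nlinarith : (0 : ℝ) ≤ q' - q)]
    linarith
  · have := (imageClock_sub_mem hW hA hne hβ ht'.1 h ht.2 hm).1
    rw [hσt, hσt'] at this
    rw [abs_of_nonneg (sub_nonneg.2 h), abs_of_nonneg (by nlinarith : (0 : ℝ) ≤ q - q')]
    linarith

/-- **`τ` is continuous on `[0, σ β]`.** [folklore] -/
theorem continuousOn_imageClockInv : ContinuousOn (imageClockInv W A β) (Icc (0 : ℝ) (imageClock W A β)) := by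
  obtain ⟨m, hm0, -, hm⟩ := exists_forall_le_imageClockRate hW hA hne hβ
  rw [Metric.continuousOn_iff]
  intro q hq ε hε
  refine ⟨ε * m, by positivity, fun q' hq' hqq' ↦ ?_⟩
  rw [Real.dist_eq] at hqq' ⊢
  calc |imageClockInv W A β q' - imageClockInv W A β q| ≤ |q' - q| / m :=
        abs_imageClockInv_sub_le hW hA hne hβ hm0 hm hq' hq
    _ < ε := by rw [div_lt_iff₀ hm0]; exact hqq'

/-- **`τ` is strictly increasing on `[0, σ β]`.** [folklore] -/
theorem strictMonoOn_imageClockInv : StrictMonoOn (imageClockInv W A β) (Icc (0 : ℝ) (imageClock W A β)) := by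
  intro q hq q' hq' hlt
  have hmono := strictMonoOn_imageClock hW hA hne hβ
  rw [← hmono.lt_iff_lt (imageClockInv_spec hW hA hne hβ hq).1 (imageClockInv_spec hW hA hne hβ hq').1,
    imageClock_imageClockInv hW hA hne hβ hq, imageClock_imageClockInv hW hA hne hβ hq']
  exact hlt

/-- Interior clock values have interior preimages: `q ∈ (0, σ β) ⇒ τ q ∈ (0, β)`. [folklore] -/
theorem imageClockInv_mem_Ioo {q : ℝ} (hq : q ∈ Ioo (0 : ℝ) (imageClock W A β)) :
    imageClockInv W A β q ∈ Ioo (0 : ℝ) β := by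
  have hq' : q ∈ Icc (0 : ℝ) (imageClock W A β) := ⟨hq.1.le, hq.2.le⟩
  have hmono := strictMonoOn_imageClockInv hW hA hne hβ
  have h0 : (0 : ℝ) ∈ Icc (0 : ℝ) (imageClock W A β) := ⟨le_rfl, hq.1.le.trans hq.2.le⟩
  have hS : imageClock W A β ∈ Icc (0 : ℝ) (imageClock W A β) := ⟨hq.1.le.trans hq.2.le, le_rfl⟩
  constructor
  · have := hmono h0 hq' hq.1
    rwa [imageClockInv_zero hW hA hne hβ] at this
  · have := hmono hq' hS hq.2
    rwa [imageClockInv_imageClock hW hA hne hβ ⟨β.coe_nonneg, le_rfl⟩] at this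

/-- **`HasDerivAt τ (d_{τ q}²)⁻¹ q` on `(0, σ β)`** (inverse function rule: `σ` has the nonzero
derivative `d²` at `τ q ∈ (0, β)` and `σ ∘ τ = id` near `q`). [cite: Lawler2005, Remark 4.5] -/
theorem hasDerivAt_imageClockInv {q : ℝ} (hq : q ∈ Ioo (0 : ℝ) (imageClock W A β)) :
    HasDerivAt (imageClockInv W A β) (imageClockRate W A (imageClockInv W A β q))⁻¹ q := by
  have hτ := imageClockInv_mem_Ioo hW hA hne hβ hq
  refine HasDerivAt.of_local_left_inverse ?_ (hasDerivAt_imageClock hW hA hne hβ hτ)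
    (imageClockRate_pos_le_one W A _).1.ne' ?_
  · exact (continuousOn_imageClockInv hW hA hne hβ).continuousAt (Icc_mem_nhds hq.1 hq.2)
  · filter_upwards [Icc_mem_nhds hq.1 hq.2] with y hy
    exact imageClock_imageClockInv hW hA hne hβ hy

end Inverse

end Loewner

end Literature.Probability.RandomPlanarGeometry

end
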